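import Summits.AtomisticToContinuum.Crystallization.Theorems.FrustratedLawDichotomyStrainedPatchHomEntryLeafHTA2QCellB9S2
import Summits.AtomisticToContinuum.Crystallization.Theorems.FrustratedLawDichotomyStrainedPatchHomEntryLeafHTA2QSq

/-!
# ★★★ THE FULL `2⁻⁹` BULK CELL END TO END WITH ONE INNER LEAF: `entryLeafOKHT4A2QQDCRS muRec qX90c pB9A2 QB9 GnB9 JB065 .leaf cB065 wB9A = true`
# (27623 `(H) HomFloor (1/625)`, hcp half; hand-1 g36; critic rows 1331 (2c) «close ONE 2⁻⁹ bulk cell END TO END = the H-side feasibility event» / 1337 «x(2⁻⁹) ≤ 630 s ⇒ PROCEED»)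

decomp-a2c hand-1 g36 (crux `AperiodicFrustratedLawGap`, stmt-AtomisticToContinuum-27623).  KERNEL: ★ `treeA2QS_B9` — ONE inner hull leaf of the SQUARED-test inner
verdict `…SqKit.entryLeafOKHQDCRS muRec qX90c` closes the sheet-tracked confined box `htWr pB9A2 = (2.661, 3.410, 1.215)e-3` (+ hull `(2.293, 2.478, 0.064)e-3`) of the
FULL `2⁻⁹` cell (seat probe Q2: `decide` 41 s; the inner verdict of record needed ≥ 256 leaves here, hand-1 g35 FINDING §3b — its linearised pair bound's remainder
`(ρ_k+ρ_{k′})²/(2(‖r_c‖−ρ_k−ρ_{k′}))` was singular on this leaf, hand-1 g36 FINDING); with `…CellB9S2.htCertSideA2Q_B9A2` (certificate side AS IS, `t = 0.018`,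
≈ 460 s): ★★★ `entryLeafOKHT4A2QQDCRS_B9A2`, whence by `…HTA2QSq.entryLeafOKHT4A2QQDCRS_sound` the hver conclusion on the whole `2⁻⁹` cell and ★ `okSE_B9`: the cell
is a one-leaf ∃-tree of the production verdict v2 `entryLeafOKHT4A2QQDCRSE muRec` (consumer `…HTA2QSq.homFloor_625_of_entryTrees6RBKP_HT4A2QQDCRSE`).
PER-CELL KERNEL COST OF RECORD for a FULL `2⁻⁹` T-cell: rest ≈ 80 s + components ≈ 3 × 90 s + lin/far ≈ 115 s + inner 41 s ≈ 500 s (`≤ 630 s` ⇒ row 1337 PROCEED band;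
census ⑤′: `2⁻⁹` available at 680 s/cell = 5.3e4 core-h, here ≈ 500 s/cell) — versus 16 mixed `…CellBMA3` cells (≈ 9000 s) or 8 `…CellBXA3` cells (≈ 5400 s) for the
same volume.

Kernel fact + assembly; 0 sorry; standard axioms; no definitions.  `--supports stmt-AtomisticToContinuum-27623`.
-/

namespace Summit.AtomisticToContinuum.Crystallization.Theorems.FrustratedLawDichotomyStrainedPatchHomEntryLeafHT

open Literature.Analysis.ValidatedNumerics.Numerics
open Summit.AtomisticToContinuum.Crystallization.Theorems.FrustratedLawDichotomyStrainedPatchHomCertTree (CertTree treeOK)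
open Summit.AtomisticToContinuum.Crystallization.Theorems.FrustratedLawDichotomyStrainedPatchHomEntryTable (muRec)
open Summit.AtomisticToContinuum.Crystallization.Theorems.FrustratedLawDichotomyStrainedPatchHomEntryFitHcpCentred (entryLeafOKHQDCRS)
open Summit.AtomisticToContinuum.Crystallization.Theorems.FrustratedLawDichotomyStrainedPatchHomSlopeLJ
open Summit.AtomisticToContinuum.Crystallization.Theorems.FrustratedLawDichotomyStrainedPatchHomSlopeLJAffine
open Summit.AtomisticToContinuum.Crystallization.Theorems.FrustratedLawDichotomyStrainedPatchHomSlopeLJAffine2Kit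

set_option maxRecDepth 100000 in
set_option maxHeartbeats 4000000 in
/-- ★ KERNEL: ONE inner hull leaf of the squared-test inner verdict closes the second-order confined box of the FULL `2⁻⁹` cell (`≈ 41 s`). -/
theorem treeA2QS_B9 : treeOK (hullInner (entryLeafOKHQDCRS muRec qX90c) JB065 cB065) CertTree.leaf cB065 (htWr pB9A2 cB065 wB9A) = true := by
  decide +kernel

/-- ★★★ **THE FULL `2⁻⁹` BULK CELL CLOSES END TO END THROUGH THE SECOND-ORDER AFFINE LEAF WITH THE SQUARED INNER TEST** (certificate as is, `t = 0.018`; one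
inner leaf). [assembly] -/
theorem entryLeafOKHT4A2QQDCRS_B9A2 : entryLeafOKHT4A2QQDCRS muRec qX90c pB9A2 QB9 GnB9 JB065 CertTree.leaf cB065 wB9A = true := by
  have h1 := htCertSideA2Q_B9A2
  have h2 := treeA2QS_B9
  unfold entryLeafOKHT4A2QQDCRS entryLeafOKHT4A2Q
  rw [h1, h2]
  rfl

/-- ★ … hence the FULL `2⁻⁹` cell is a one-leaf ∃-tree of the production verdict v2 `entryLeafOKHT4A2QQDCRSE muRec`. [formal bookkeeping] -/
theorem okSE_B9 : ∃ t : CertTree ((Fin 3 × Fin 3) ⊕ Fin 3), treeOK (entryLeafOKHT4A2QQDCRSE muRec) t cB065 wB9A = true :=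
  exists_tree_HT4A2QQDCRSE_of_certS entryLeafOKHT4A2QQDCRS_B9A2

end Summit.AtomisticToContinuum.Crystallization.Theorems.FrustratedLawDichotomyStrainedPatchHomEntryLeafHT
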